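import Summits.ResolutionOfSingularities.ResolutionOfSingularities.Theorems.PurelyInseparableDim4ResConeLSectorKillPrime
import Summits.ResolutionOfSingularities.ResolutionOfSingularities.Theorems.PurelyInseparableDim4ResConePowerConeFormSupport
import Summits.ResolutionOfSingularities.ResolutionOfSingularities.Theorems.PurelyInseparableDim4ResConeLossFreeTwins
import HarnessLib
import HarnessLib.Audit.Tags

/-!
# Purely inseparable four-folds — LOSS-FREE L-SECTOR POWER-CONE TAILS ARE LIGHT: twin weight `n ≤ d − 3`, every prime, every shade
# (cell `res-dim4-pi`, K2(p) lane, B rows = power cones `e_G = 3`; composition of `…LSectorKillPrime` with res-dim4-p-2's frozen twins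
# and res-dim4-p-1's frozen form support)

[OURS · counted 0 · cell `res-dim4-pi` · K2(p) lane (holder res-dim4-p-12 g5, ruling g5-18 GO «the LOSSY-or-not L-sector row») · seat
res-dim4-p-5 g6.]  Nothing here proves any TAIL(p, d, 3), K2(7), K2(p), `NoIsolatedTrap p p` or resolution of singularities in dimension ≥ 4
/ characteristic `p` — NOT proved; a statement about OUR frame's hypothetical `Step0 p` tails.  AI kernel work, weaker than expert review.

THE ROW.  A witnessed isolated above-floor `Step0 p` tail with `x^{r₀} ∣ F₀` and constant shade `d ≥ 2`, with power-cone data (`ℓ k ≠ 0`,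
direction equation, propagation, `resForm = a_k ℓ_k^d` — the output of `chain_powerCone_package`), which is
* LOSS-FREE from `k₀` (a translated letter is a free letter) — res-dim4-p-2 g6 `lossfree_frozen_twins` (p716452): the weights freeze,
  every late chart letter is a TWIN of weight `n = |r| + d − p`;
* in the L-SECTOR from `k₀` (every free letter is killed by the form) — res-dim4-p-1 g6 `exists_frozen_formSupport_of_L` (p716866): the form
  freezes on a permanent set `N`;
* and has a FREE letter at every late time,
satisfies **`n + 3 ≤ d`** (`lossfree_lSector_twin_weight_add_three_le`): at a late satellite pair `(m, m+1)` (FT, `exists_satellite_ge`) the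
two charts are distinct twins, `N` is kept, the free letter lies outside, and `…LSectorKillPrime`'s `lSector_change_false` fires exactly when
`d ≤ n + 2`.  Equivalently the frozen boundary weight is `|r| ≤ p − 3` and the frozen order `p + n ≤ p + d − 3`.  So for every prime the
loss-free L-sector with a free letter is EMPTY at `d = 3` (all `n ≥ 1`), and at `p = 7` it is confined to the twins `(1,1) + x_ν^2` at
`d = 4` and `(1,1) + x_ν` at `d = 5` (DATUM 6 of the p-5 lineage: these light classes resist every exponent count).
[cite: CossartJannsenSaito2020, Thm. 3.10(4), Thm. 3.14] [cite: HauserPerlega2019PRIMS, §2 (transform D′ of D)]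
[cite: CossartPiltant2009, Ch. 4 Def. I.1, Thm. I.3]
bears_on: LADDER-RESOLUTION:D157-DOOR2 (res-dim4-pi · K2(p) B rows · loss-free L-sector light ∀ p).  Supports stmt-ResolutionOfSingularities-16155
(helper).
-/

set_option linter.dupNamespace false -- mandated namespace of this single-conjunct summit

noncomputable section

namespace Summit.ResolutionOfSingularities.ResolutionOfSingularities.Theorems.PIDim4

namespace ResCone

open MvPolynomial Finset
open Literature.AlgebraicGeometry.Resolution
open Literature.AlgebraicGeometry.Resolution.CentreBlowup
open Literature.AlgebraicGeometry.Resolution.Hauser2010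
open Literature.AlgebraicGeometry.Resolution.HauserPerlega2019

variable {K : Type} [Field K] [DecidableEq K]

/-- **LOSS-FREE L-SECTOR POWER-CONE TAILS ARE LIGHT (every prime `p`, every shade `d ≥ 2`).**  On a witnessed isolated above-floor
`Step0 p` chain with `x^{r₀} ∣ F₀` and constant shade `d` from `k₀`, carrying power-cone data `ℓ, a, λ` (forms `ℓ k ≠ 0` with the direction
equation and the propagation law, `resForm (c k) = C (a k) * (Σ ℓ k i xᵢ)^d`), LOSS-FREE from `k₀` (`b k i ≠ 0 → r_k i = 0`), in the L-SECTOR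
from `k₀` (`r_k i = 0 → ℓ k i = 0`) and with a FREE letter at every time `≥ k₀`: from some `K₁ ≥ k₀` on the weight of every chart letter (the
twin weight `n`) satisfies `n + 3 ≤ d`, and the total boundary weight satisfies `|r| + 3 ≤ p`. [OURS]
[cite: CossartJannsenSaito2020, Thm. 3.10(4), Thm. 3.14] [cite: HauserPerlega2019PRIMS, §2 (transform D′ of D)] -/
theorem lossfree_lSector_twin_weight_add_three_le (p : ℕ) [Fact p.Prime] [CharP K p] {c : ℕ → State K} {j : ℕ → Fin 4}
    {b : ℕ → Fin 4 → K} (hc : ∀ k, IsIsolated p (c k).F ∧ Step0 p (c k) (c (k + 1)))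
    (hw : FreeTail.IsWitnessedChain p c j b) (hr0 : ∀ e ∈ (c 0).F.support, (c 0).r ≤ e)
    (hfloor : ∀ k, ordZero (c k).F ≠ p) {k₀ d : ℕ} (hd : 2 ≤ d) (hshade : ∀ k, k₀ ≤ k → (c k).shade = (d : ℕ∞))
    {ℓ : ℕ → Fin 4 → K} {a lam : ℕ → K} (hℓ0 : ∀ k, k₀ ≤ k → ℓ k ≠ 0)
    (hdir : ∀ k, k₀ ≤ k → ℓ k (j k) + dotProduct (ℓ k) (b k) = 0) (hlam : ∀ k, k₀ ≤ k → lam k ≠ 0)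
    (hprop : ∀ k, k₀ ≤ k → ∀ i, i ≠ j k → ℓ (k + 1) i = lam k * ℓ k i)
    (hform : ∀ k, k₀ ≤ k → resForm (c k) = C (a k) * (∑ i, C (ℓ k i) * X i) ^ d)
    (hloss : ∀ k, k₀ ≤ k → ∀ i, b k i ≠ 0 → (c k).r i = 0)
    (hL : ∀ k, k₀ ≤ k → ∀ i, (c k).r i = 0 → ℓ k i = 0)
    (hfree : ∀ k, k₀ ≤ k → ∃ φ, (c k).r φ = 0) :
    ∃ K₁, k₀ ≤ K₁ ∧ ∀ k, K₁ ≤ k → (c k).r (j k) + 3 ≤ d ∧ (c k).r.degree + 3 ≤ p := by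
  classical
  obtain ⟨-, -, -, hband, -⟩ := tail_weights_laws hc hw hr0 hfloor hshade
  -- frozen twins (res-dim4-p-2)
  obtain ⟨K₁, hK₁, hconst, hchart, -⟩ := lossfree_frozen_twins hc hw hr0 hfloor hshade hloss
  -- frozen form support (res-dim4-p-1)
  obtain ⟨k₂, hk₂, N, hNne, -, hmemN, hperm⟩ :=
    exists_frozen_formSupport_of_L p hc hw hfloor hℓ0 hdir hlam hprop (le_refl k₀) hL
  refine ⟨K₁, hK₁, fun k hk => ?_⟩
  -- the twin weight `n` and the frozen total weight
  have hn : (c k).r (j k) = (c K₁).r.degree + d - p := by rw [hconst k hk]; exact hchart k hk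
  have hbandK := hband K₁ hK₁
  have hdegk : (c k).r.degree = (c K₁).r.degree := by rw [hconst k hk]
  -- suppose `d ≤ n + 2`: fire the letter change kill at a late satellite pair
  suffices h : (c K₁).r.degree + 3 ≤ p by
    refine ⟨?_, by rw [hdegk]; exact h⟩
    rw [hn]; omega
  by_contra hlt
  push Not at hlt
  obtain ⟨m, hm, hsat⟩ := exists_satellite_ge p hc hw (max K₁ k₂)
  have hmK : K₁ ≤ m := le_trans (le_max_left _ _) hm
  have hmk : k₂ ≤ m := le_trans (le_max_right _ _) hm
  have hm0 : k₀ ≤ m := le_trans hK₁ hmK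
  obtain ⟨φ, hφ⟩ := hfree m hm0
  obtain ⟨κ, hκ⟩ := hNne
  -- weights at `m` and `m + 1` are the frozen ones
  have hrm : (c m).r = (c K₁).r := hconst m hmK
  have hrm1 : (c (m + 1)).r = (c K₁).r := hconst (m + 1) (by omega)
  have hA : (c K₁).r (j m) = (c K₁).r.degree + d - p := hchart m hmK
  have hB : (c K₁).r (j (m + 1)) = (c K₁).r.degree + d - p := hchart (m + 1) (by omega)
  have hφ0 : (c K₁).r φ = 0 := by rw [← hrm]; exact hφ
  have hκ1 : 1 ≤ (c K₁).r κ := by rw [← hrm]; exact (hperm κ hκ m hmk).1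
  -- the letters `j m`, `j (m+1)`, `φ`, `κ` are pairwise distinct
  have hAB : j m ≠ j (m + 1) := fun h => hsat.1 h.symm
  have hAφ : j m ≠ φ := fun h => by rw [h, hφ0] at hA; omega
  have hBφ : j (m + 1) ≠ φ := fun h => by rw [h, hφ0] at hB; omega
  have hAκ : j m ≠ κ := (hperm κ hκ m hmk).2.1
  have hBκ : j (m + 1) ≠ κ := (hperm κ hκ (m + 1) (by omega)).2.1
  have hφκ : φ ≠ κ := fun h => by rw [h] at hφ0; omega
  have hdeg4 := degree_eq_four_apply hAB hAκ hAφ hBκ.symm.symm hBφ hφκ.symm (c K₁).r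
  -- the kill, with `Kset = N`
  refine lSector_change_false p hc hw hr0 hfloor hd hshade hform hm0 (Kset := N) (fun h => (hperm _ h m hmk).2.1 rfl)
    (fun h => (hperm _ h (m + 1) (by omega)).2.1 rfl) hAB (fun hU => ?_) (fun i hi => ?_) (fun i hi => ?_)
    (fun i hi => (hperm i hi m hmk).2.2) (fun i hi => (hperm i hi (m + 1) (by omega)).2.2) hsat.2 ?_
  · -- `φ` lies outside `{j m, j (m+1)} ∪ N`
    have hφU : φ ∈ insert (j m) (insert (j (m + 1)) N) := hU ▸ Finset.mem_univ φ
    simp only [Finset.mem_insert] at hφU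
    rcases hφU with h | h | h
    · exact hAφ h.symm
    · exact hBφ h.symm
    · have := (hperm φ h m hmk).1
      rw [hrm, hφ0] at this
      omega
  · by_contra hne
    exact hi ((hmemN m hmk i).mp hne)
  · by_contra hne
    exact hi ((hmemN (m + 1) (by omega) i).mp hne)
  · -- the numeric condition from `d ≤ n + 2`
    have hκle : (c K₁).r κ ≤ ∑ i ∈ N, (c m).r i := by
      rw [hrm]
      exact Finset.single_le_sum (fun i _ => Nat.zero_le _) hκ
    rw [hrm1, hrm] at *
    rw [hdeg4, hφ0] at hA hB hbandK hlt ⊢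
    omega

end ResCone

end Summit.ResolutionOfSingularities.ResolutionOfSingularities.Theorems.PIDim4

end
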